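/-
Copyright (c) 2026. All rights reserved.
Released under Apache 2.0 license as described in the file LICENSE.
-/
import Literature.AlgebraicGeometry.Pohlmann1968.AbelianCMFieldStabilizerExceptionalClasses
import HarnessLib

/-!
# A divisibility obstruction: `2·(Rank(Φ) − 1) ∤ [K:ℚ]` forces exceptional Hodge classes

SETTING (tree `CMTypeRankStabilizerBoundHazamaCriterion`, `AbelianCMFieldStabilizerExceptionalClasses`).  `K` a CM
field Galois over `ℚ`, `Φ` any CM type, `A` any abelian variety of type `(K; Φ)`.  All Hodge classes on all powers of
`A` are divisorial iff `2·|Stab(Φ)|·(Rank(Φ) − 1) = [K:ℚ]`; reading this equality as a DIVISIBILITY gives an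
obstruction that needs only the rank:

> **Theorem** (`exists_exceptional_pow_of_not_dvd`, `exists_exceptional_of_not_dvd`).  `K/ℚ` Galois CM: if
> `2·(Rank(Φ) − 1)` does not divide `[K:ℚ]`, some power of every abelian variety of type `(K; Φ)` carries an
> exceptional Hodge class; for `K` abelian, `A` itself does.
> **Theorem** (`exists_exceptional_of_forall_cmTypeRank_ne_two_pow_add_one`).  `K` multiquadratic
> (`Gal(K/ℚ)` of exponent `2`, `[K:ℚ] = 2^{n+1}`): unless `Rank(Φ) = 2ᵏ + 1` for some `k`, EVERY abelian variety of
> type `(K; Φ)` carries an exceptional Hodge class; e.g. for `[K:ℚ] = 32` every type of rank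
> `∉ {2, 3, 5, 9, 17}` (`exists_exceptional_of_finrank_eq_thirtytwo`).

(The ranks `2, 3, 5, 9, 17` at degree `32` are realised WITHOUT exceptional classes by the types induced from
nondegenerate types of the CM subfields of degree `2, 4, 8, 16, 32`; the primitive types of rank `9, 11, 13` of the
tree (g39-#4) and every type of rank `6, 7, 10, …, 16` carry them.)

* `two_mul_cmTypeRank_sub_one_dvd_of_forall_pow_hodgeClassSpan_eq`, `exists_exceptional_pow_of_not_dvd` (Galois `K`),
  `two_mul_cmTypeRank_sub_one_dvd_of_forall_hodgeClassSpan_eq`, `exists_exceptional_of_not_dvd` (abelian `K`),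
  `exists_cmTypeRank_eq_two_pow_add_one_of_forall_hodgeClassSpan_eq`,
  **`exists_exceptional_of_forall_cmTypeRank_ne_two_pow_add_one`**, `exists_exceptional_of_finrank_eq_thirtytwo`
  (multiquadratic `K`).

HONEST SCOPE.  Elementary consequences of the stabiliser criterion (tree); nothing on the algebraicity of the
exceptional classes.  THEOREMS ONLY: no definition, no named fact, no instance, no `sorry`.

## References

* [Gordon1999HodgeAVSurvey] B. B. Gordon, *A survey of the Hodge conjecture for abelian varieties*, Thm. 6.4, §9.2.
* [White1993SporadicCycles] S. P. White, *Sporadic cycles on CM abelian varieties*, Compositio Math. 88 (1993), §4 Thm. 3.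
* [Kubota1965] T. Kubota, *On the field extension by complex multiplication*, Trans. AMS 118 (1965), §2, §4 Lemma 2.
* [Dodson1984] B. Dodson, *The structure of Galois groups of CM-fields*, Trans. AMS 283 (1984), §3.1.1, §3.2.1.
* [Shimura1998] G. Shimura, *Abelian Varieties with Complex Multiplication and Modular Functions*, §8.2 Prop. 26.

## Provenance

Lane `lit-hodgefound` (Track 2, Layer A5), seat `lit-hodgefound-p10` generation 39, row g39-#12; neighbours cited by
name, nothing restated: `CMTypeRankStabilizerBoundHazamaCriterion` (g39-#8), `AbelianCMFieldStabilizerExceptionalClasses`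
(g39-#9), `CMTypeRankStabilizerBound` (g39-#7), `NondegenerateCMTypeDivisorClasses` (`cmTypeRank_le`),
`SimpleDegenerateCMAbelianVarietiesCompositeDimension` (`card_gal_eq_finrank`).
-/

open scoped BigOperators NumberField Classical
open NumberField Module CategoryTheory CategoryTheory.Limits IntermediateField

namespace Literature.AlgebraicGeometry.Pohlmann1968

open scoped Literature.NumberTheory.ComplexMultiplication
open Literature.NumberTheory.ComplexMultiplication (twistStabilizer)
open Literature.AlgebraicGeometry.Motives (CMType AbelianVariety)
open Literature.AlgebraicGeometry.HodgeTheory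
open Literature.AlgebraicGeometry.VanGeemen1994 (hodgeClassSpan)
open Literature.Barriers.HodgeConjecture (divisorClassesSpan)
open Literature.AlgebraicGeometry.ComplexMultiplication (IsCMTypeRealisation)

variable {K : Type} [Field K] [NumberField K] [IsCMField K]
  {A : AbelianVariety ℂ} {ι : 𝓞 K →+* End A} {θ : K →+* Module.End ℂ (complexBetti A.X 1)}

/-! ## §1 Galois CM fields: powers -/

section Galois

variable [IsGalois ℚ K]

/-- **`Bᵐ(Aⁿ) ⊗ ℂ = Dᵐ(Aⁿ) ⊗ ℂ` for all `n, m` ⟹ `2·(Rank(Φ) − 1) ∣ [K:ℚ]`** (`K/ℚ` Galois; the quotient is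
`|Stab(Φ)|`). [cite: Gordon1999HodgeAVSurvey, Thm. 6.4] [cite: Shimura1998, §8.2 Prop. 26] -/
theorem two_mul_cmTypeRank_sub_one_dvd_of_forall_pow_hodgeClassSpan_eq (Φ : CMType K)
    (hA : IsCMTypeRealisation Φ A ι θ)
    (h : ∀ n m : ℕ, hodgeClassSpan (⨁ fun _ : Fin n => A).dim (⨁ fun _ : Fin n => A).X m =
      divisorClassesSpan (⨁ fun _ : Fin n => A).X (⨁ fun _ : Fin n => A).dim m) :
    2 * (cmTypeRank Φ - 1) ∣ finrank ℚ K :=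
  ⟨Nat.card (twistStabilizer Φ), by
    rw [← (two_mul_natCard_twistStabilizer_mul_eq_iff_forall_pow_hodgeClassSpan_eq Φ hA).2 h]; ring⟩

/-- **`K/ℚ` Galois CM, `2·(Rank(Φ) − 1) ∤ [K:ℚ]` ⟹ some power of `A` carries an exceptional Hodge class**, for every
abelian variety `A` of type `(K; Φ)`. [cite: Gordon1999HodgeAVSurvey, Thm. 6.4 and §9.2] -/
theorem exists_exceptional_pow_of_not_dvd (Φ : CMType K) (hndvd : ¬ 2 * (cmTypeRank Φ - 1) ∣ finrank ℚ K)
    (hA : IsCMTypeRealisation Φ A ι θ) :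
    ∃ n m : ℕ, ∃ c : complexBetti (⨁ fun _ : Fin n => A).X (2 * m), IsRationalClass c ∧
      IsOfHodgeType (⨁ fun _ : Fin n => A).dim (⨁ fun _ : Fin n => A).X (2 * m) m m c ∧
      c ∉ divisorClassesSpan (⨁ fun _ : Fin n => A).X (⨁ fun _ : Fin n => A).dim m := by
  rcases forall_pow_hodgeClassSpan_eq_or_exists_exceptional Φ hA with ⟨-, h⟩ | ⟨-, h⟩
  · exact absurd (two_mul_cmTypeRank_sub_one_dvd_of_forall_pow_hodgeClassSpan_eq Φ hA h) hndvd
  · exact h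

end Galois

/-! ## §2 Abelian CM fields: `A` itself -/

section Abelian

variable [IsAbelianGalois ℚ K]

/-- **`K` abelian CM: `Bᵐ(A) ⊗ ℂ = Dᵐ(A) ⊗ ℂ` for all `m` ⟹ `2·(Rank(Φ) − 1) ∣ [K:ℚ]`.**
[cite: Gordon1999HodgeAVSurvey, Thm. 6.4] [cite: White1993SporadicCycles, §4 Theorem 3] -/
theorem two_mul_cmTypeRank_sub_one_dvd_of_forall_hodgeClassSpan_eq (Φ : CMType K)
    (hA : IsCMTypeRealisation Φ A ι θ)
    (h : ∀ m : ℕ, hodgeClassSpan (finrank ℚ K / 2) A.X m = divisorClassesSpan A.X (finrank ℚ K / 2) m) :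
    2 * (cmTypeRank Φ - 1) ∣ finrank ℚ K :=
  ⟨Nat.card (twistStabilizer Φ), by
    rw [← (two_mul_natCard_twistStabilizer_mul_eq_iff_forall_hodgeClassSpan_eq Φ hA).2 h]; ring⟩

/-- **`K` abelian CM, `2·(Rank(Φ) − 1) ∤ [K:ℚ]` ⟹ `A` carries an exceptional Hodge class**, for every abelian variety
`A` of type `(K; Φ)`. [cite: Gordon1999HodgeAVSurvey, Thm. 6.4 and §9.2] [cite: White1993SporadicCycles, §4 Theorem 3] -/
theorem exists_exceptional_of_not_dvd (Φ : CMType K) (hndvd : ¬ 2 * (cmTypeRank Φ - 1) ∣ finrank ℚ K)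
    (hA : IsCMTypeRealisation Φ A ι θ) :
    ∃ m : ℕ, ∃ c : complexBetti A.X (2 * m), IsRationalClass c ∧
      IsOfHodgeType (finrank ℚ K / 2) A.X (2 * m) m m c ∧ c ∉ divisorClassesSpan A.X (finrank ℚ K / 2) m := by
  rcases hodgeClassSpan_eq_or_exists_exceptional Φ hA with ⟨-, h⟩ | ⟨-, h⟩
  · exact absurd (two_mul_cmTypeRank_sub_one_dvd_of_forall_hodgeClassSpan_eq Φ hA h) hndvd
  · exact h

end Abelian

/-! ## §3 Multiquadratic CM fields: `Rank(Φ) = 2ᵏ + 1` or exceptional classes -/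

section Multiquadratic

variable [IsGalois ℚ K]

omit [IsCMField K] in
/-- The degree of a Galois field with Galois group of exponent `2` is a power of `2`. [cite: Dodson1984, §3.1.1] -/
private theorem finrank_eq_two_pow_rd (hexp : ∀ g : K ≃ₐ[ℚ] K, g ^ 2 = 1) : ∃ n : ℕ, finrank ℚ K = 2 ^ n := by
  haveI : Fact (Nat.Prime 2) := ⟨Nat.prime_two⟩
  have hp : IsPGroup 2 (K ≃ₐ[ℚ] K) := fun g => ⟨1, by rw [pow_one]; exact hexp g⟩
  obtain ⟨n, hn⟩ := IsPGroup.iff_card.1 hp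
  exact ⟨n, by rw [← IsGalois.card_aut_eq_finrank, hn]⟩

/-- **Multiquadratic `K`: `Bᵐ(A) ⊗ ℂ = Dᵐ(A) ⊗ ℂ` for all `m` ⟹ `Rank(Φ) = 2ᵏ + 1`** (`2·(Rank − 1)` divides
`[K:ℚ] = 2^{n+1}`). [cite: Kubota1965, §2 and §4 Lemma 2] [cite: Dodson1984, §3.2.1] [cite: Gordon1999HodgeAVSurvey, Thm. 6.4] -/
theorem exists_cmTypeRank_eq_two_pow_add_one_of_forall_hodgeClassSpan_eq (hexp : ∀ g : K ≃ₐ[ℚ] K, g ^ 2 = 1)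
    (Φ : CMType K) (hA : IsCMTypeRealisation Φ A ι θ)
    (h : ∀ m : ℕ, hodgeClassSpan (finrank ℚ K / 2) A.X m = divisorClassesSpan A.X (finrank ℚ K / 2) m) :
    ∃ k : ℕ, cmTypeRank Φ = 2 ^ k + 1 := by
  haveI := Multiquadratic.isAbelianGalois_of_forall_sq_eq_one hexp
  obtain ⟨n, hn⟩ := finrank_eq_two_pow_rd hexp
  have hdvd : cmTypeRank Φ - 1 ∣ 2 ^ n :=
    hn ▸ dvd_of_mul_left_dvd (two_mul_cmTypeRank_sub_one_dvd_of_forall_hodgeClassSpan_eq Φ hA h)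
  obtain ⟨k, -, hk⟩ := (Nat.dvd_prime_pow Nat.prime_two).1 hdvd
  have hk1 : 1 ≤ 2 ^ k := Nat.one_le_two_pow
  exact ⟨k, by omega⟩

/-- **MULTIQUADRATIC `K`: UNLESS `Rank(Φ) = 2ᵏ + 1`, EVERY ABELIAN VARIETY OF TYPE `(K; Φ)` CARRIES AN EXCEPTIONAL HODGE
CLASS.** [cite: Kubota1965, §2] [cite: White1993SporadicCycles, §4 Theorem 3] [cite: Gordon1999HodgeAVSurvey, Thm. 6.4 and §9.2] -/
theorem exists_exceptional_of_forall_cmTypeRank_ne_two_pow_add_one (hexp : ∀ g : K ≃ₐ[ℚ] K, g ^ 2 = 1)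
    (Φ : CMType K) (hr : ∀ k : ℕ, cmTypeRank Φ ≠ 2 ^ k + 1) (hA : IsCMTypeRealisation Φ A ι θ) :
    ∃ m : ℕ, ∃ c : complexBetti A.X (2 * m), IsRationalClass c ∧
      IsOfHodgeType (finrank ℚ K / 2) A.X (2 * m) m m c ∧ c ∉ divisorClassesSpan A.X (finrank ℚ K / 2) m := by
  haveI := Multiquadratic.isAbelianGalois_of_forall_sq_eq_one hexp
  rcases hodgeClassSpan_eq_or_exists_exceptional Φ hA with ⟨-, h⟩ | ⟨-, h⟩
  · obtain ⟨k, hk⟩ := exists_cmTypeRank_eq_two_pow_add_one_of_forall_hodgeClassSpan_eq hexp Φ hA h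
    exact absurd hk (hr k)
  · exact h

/-- **`[K:ℚ] = 32` (multiquadratic): every CM type of rank `∉ {2, 3, 5, 9, 17}` puts an exceptional Hodge class on
every abelian variety of its type** (the rank is at most `17`). [cite: Kubota1965, §2] [cite: White1993SporadicCycles, §4 Theorem 3]
[cite: Gordon1999HodgeAVSurvey, §9.2] -/
theorem exists_exceptional_of_finrank_eq_thirtytwo (hexp : ∀ g : K ≃ₐ[ℚ] K, g ^ 2 = 1) (h32 : finrank ℚ K = 32)
    (Φ : CMType K) (h2 : cmTypeRank Φ ≠ 2) (h3 : cmTypeRank Φ ≠ 3) (h5 : cmTypeRank Φ ≠ 5) (h9 : cmTypeRank Φ ≠ 9)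
    (h17 : cmTypeRank Φ ≠ 17) (hA : IsCMTypeRealisation Φ A ι θ) :
    ∃ m : ℕ, ∃ c : complexBetti A.X (2 * m), IsRationalClass c ∧
      IsOfHodgeType (finrank ℚ K / 2) A.X (2 * m) m m c ∧ c ∉ divisorClassesSpan A.X (finrank ℚ K / 2) m := by
  refine exists_exceptional_of_forall_cmTypeRank_ne_two_pow_add_one hexp Φ (fun k hk => ?_) hA
  have hle : cmTypeRank Φ ≤ finrank ℚ K / 2 + 1 := cmTypeRank_le Φ
  rw [h32] at hle
  rcases Nat.lt_or_ge k 5 with hk5 | hk5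
  · interval_cases k <;> omega
  · have : 2 ^ 5 ≤ 2 ^ k := Nat.pow_le_pow_right (by norm_num) hk5
    omega

end Multiquadratic

end Literature.AlgebraicGeometry.Pohlmann1968
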